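import Summits.KontsevichZagierPeriods.KontsevichZagierPeriods.Theses.HurwitzMicroSectors

/-!
# `DilationMove` (stmt-KontsevichZagierPeriods-3872) — negative side: load-bearing hypotheses and tightness

Refuter (`cdisprove`) by-products for the crux `DilationMove` of route `HurwitzMicroSectors`
(the dilation `x ↦ (xᵢ^m)ᵢ` of the open unit box as ONE change-of-variables move, Jacobian factor
`mⁿ·∏ᵢ xᵢ^(m-1)`). The crux itself is TRUE (candidate proofs attached to the item; the work file
`Cruxes/DilationMove/Disproof.lean` §P); this file records what ANY proof must use.

* §0 kit: interval boxes `(a,b)ⁿ` with rational corners are `ℚ`-semialgebraic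
  (`isSemialgebraic_ibox`); monomial reps `monoRep a b c k = [(a,b), c·t^k]` in dimension 1, their
  values `c·∫_a^b t^k` (`value_monoRep`, `value_monoRep_unit`); the refutation channel
  `value_eq_of_mem` (soundness of the change-of-variables move).
* two parametrised families with anchors: `DilationMoveBoxes n m a b a' b'` (source/target boxes
  varied; `dilationMove_iff_boxes`) and `DilationMoveJac n m c k` (Jacobian factor `c·∏ xᵢ^k`;
  `dilationMove_iff_jac`).
* §A every hypothesis is load-bearing: `dilationMove_false_without_oneLe` (m = 0: the typed factor
  `0¹·t^(0-1)` vanishes), `dilationMove_false_without_source`, `dilationMove_false_without_target`,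
  `dilationMove_false_without_jacobian`; and two false variants: both boxes `(1,2)`
  (`not_dilationMoveBoxes_shifted`: the unit box is the only interval box stable under `t ↦ t^m`)
  and both boxes `(-1,1)` (`not_dilationMoveBoxes_symm`: non-injective, signed Jacobian).
* §B tightness in dimension 1: the move with factor `c·t^k` (`c ∈ ℚ`) forces `(c, k) = (m, m−1)`
  (`dilationMoveJac_one_necessary`, two test integrands `1` and `t`); with the crux this is an iff
  (`dilationMoveJac_one_iff_of`).
[Kontsevich–Zagier 2001, §1.2, rule (2)]
-/

noncomputable section

open MeasureTheory Set MvPolynomial intervalIntegral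
open Literature.NumberTheory.Transcendental Literature.ModelTheory.ExponentialFields

namespace Summit.KontsevichZagierPeriods.HurwitzMicroSectors.DilationMoveNegative

open Summit.KontsevichZagierPeriods.KontsevichZagierPeriods.Theses.HurwitzMicroSectors (DilationMove)

/-! ## §0 Kit -/

/-- The open interval box `(a,b)ⁿ ⊆ ℝⁿ` with rational corners, in the shape typed in the crux.
[folklore] -/
def ibox (n : ℕ) (a b : ℚ) : Set (Fin n → ℝ) := {x | ∀ i, x i ∈ Ioo (a : ℝ) b}

/-- The unit box of the crux is `ibox n 0 1`. [folklore] -/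
theorem ibox_zero_one (n : ℕ) : ibox n 0 1 = {x : Fin n → ℝ | ∀ i, x i ∈ Ioo (0 : ℝ) 1} := by
  simp [ibox]

/-- Interval boxes with rational corners are `ℚ`-semialgebraic. [folklore] -/
theorem isSemialgebraic_ibox (n : ℕ) (a b : ℚ) : IsSemialgebraic ℚ (ibox n a b) := by
  have h : ∀ i : Fin n, IsSemialgebraic ℚ {x : Fin n → ℝ | x i ∈ Ioo (a : ℝ) b} := by
    intro i
    have h1 := (isSemialgebraic_setOf_eval_lt (k := ℚ) (R := ℝ) (ι := Fin n) (C a) (X i)).inter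
      (isSemialgebraic_setOf_eval_lt (k := ℚ) (R := ℝ) (ι := Fin n) (X i) (C b))
    have hEq : {x : Fin n → ℝ | x i ∈ Ioo (a : ℝ) b} =
        {x : Fin n → ℝ | aeval x (C a : MvPolynomial (Fin n) ℚ) < aeval x (X i : MvPolynomial (Fin n) ℚ)} ∩
        {x : Fin n → ℝ | aeval x (X i : MvPolynomial (Fin n) ℚ) < aeval x (C b : MvPolynomial (Fin n) ℚ)} := by
      ext x
      simp
    rw [hEq]
    exact h1
  have hEq : ibox n a b = ⋂ i ∈ (Finset.univ : Finset (Fin n)), {x : Fin n → ℝ | x i ∈ Ioo (a : ℝ) b} := by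
    ext x
    simp [ibox]
  rw [hEq]
  exact IsSemialgebraic.biInter _ _ fun i _ => h i

/-- `ibox n a b ⊆ [a,b]ⁿ`. [folklore] -/
theorem ibox_subset_Icc (n : ℕ) (a b : ℚ) :
    ibox n a b ⊆ Icc (fun _ => (a : ℝ)) (fun _ => (b : ℝ)) := by
  intro x hx
  exact ⟨fun i => (hx i).1.le, fun i => (hx i).2.le⟩

/-- The monomial representation `[(a,b), t ↦ c·t^k]` in dimension 1 (`c ∈ ℚ`). [folklore] -/
def monoRep (a b c : ℚ) (k : ℕ) : KZ.IntegralRep 1 where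
  domain := ibox 1 a b
  integrand := fun x => (c : ℝ) * x 0 ^ k
  isSemialgebraic_domain := isSemialgebraic_ibox 1 a b
  isSemialgebraicFunOn_integrand :=
    (isSemialgebraicFunOn_aeval (isSemialgebraic_ibox 1 a b) (C c * X 0 ^ k)).congr
      (fun x _ => by simp)
  integrableOn :=
    ((continuous_const.mul ((continuous_apply 0).pow k)).continuousOn.integrableOn_compact
      isCompact_Icc).mono_set (ibox_subset_Icc 1 a b)

/-- Auxiliary: `monoRep_domain`. [folklore] -/
@[simp] theorem monoRep_domain (a b c : ℚ) (k : ℕ) : (monoRep a b c k).domain = ibox 1 a b := rfl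

/-- Auxiliary: `monoRep_integrand`. [folklore] -/
@[simp] theorem monoRep_integrand (a b c : ℚ) (k : ℕ) :
    (monoRep a b c k).integrand = fun x => (c : ℝ) * x 0 ^ k := rfl

/-- The 1-box is the preimage of the interval under `x ↦ x 0`. [folklore] -/
theorem ibox_one_eq_preimage (a b : ℚ) :
    ibox 1 a b = (MeasurableEquiv.funUnique (Fin 1) ℝ) ⁻¹' Ioo (a : ℝ) b := by
  ext x
  simp [ibox, Fin.forall_fin_one, MeasurableEquiv.funUnique]

/-- Value of a monomial representation: `c · ∫_a^b t^k dt`. [folklore] -/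
theorem value_monoRep (a b c : ℚ) (k : ℕ) (hab : (a : ℝ) ≤ b) :
    (monoRep a b c k).value = c * ∫ t in (a : ℝ)..b, t ^ k := by
  have h := (volume_preserving_funUnique (Fin 1) ℝ).setIntegral_preimage_emb
      (MeasurableEquiv.measurableEmbedding _) (fun t : ℝ => (c : ℝ) * t ^ k) (Ioo (a : ℝ) b)
  rw [KZ.IntegralRep.value, monoRep_domain, monoRep_integrand, ibox_one_eq_preimage]
  have h' : (fun x : Fin 1 → ℝ => (c : ℝ) * x 0 ^ k) =
      fun x => (c : ℝ) * (MeasurableEquiv.funUnique (Fin 1) ℝ) x ^ k := by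
    funext x
    simp [MeasurableEquiv.funUnique]
  rw [h']
  refine h.trans ?_
  rw [intervalIntegral.integral_of_le hab, integral_Ioc_eq_integral_Ioo]
  exact integral_const_mul _ _

/-- THE REFUTATION CHANNEL: a change-of-variables relation `[r] − [r']` forces equal values
(soundness, `KZ.eval_eq_zero_of_mem_changeOfVariablesRel_holds`). [folklore] -/
theorem value_eq_of_mem {n : ℕ} {r r' : KZ.IntegralRep n}
    (h : KZ.of r - KZ.of r' ∈ KZ.changeOfVariablesRel) : r.value = r'.value := by
  have := KZ.eval_eq_zero_of_mem_changeOfVariablesRel_holds h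
  rwa [map_sub, KZ.eval_of, KZ.eval_of, sub_eq_zero] at this

/-! ## The two parametrised families around the crux -/

/-- FAMILY 1 (domains). The crux at fixed `(n, m)` with the source box `(a,b)ⁿ` and the target box
`(a',b')ⁿ` in place of `(0,1)ⁿ`, `(0,1)ⁿ`. [folklore] -/
def DilationMoveBoxes (n m : ℕ) (a b a' b' : ℚ) : Prop :=
  ∀ (r r' : KZ.IntegralRep n), r.domain = ibox n a b → r'.domain = ibox n a' b' →
    (∀ x ∈ r.domain, r.integrand x =
      r'.integrand (fun i => x i ^ m) * ((m : ℝ) ^ n * ∏ i, x i ^ (m - 1))) →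
    KZ.of r - KZ.of r' ∈ KZ.changeOfVariablesRel

/-- FAMILY 2 (Jacobian). The crux at fixed `(n, m)` with the Jacobian factor `mⁿ · ∏ᵢ xᵢ^(m-1)`
replaced by `c · ∏ᵢ xᵢ^k` (`c ∈ ℚ`, `k ∈ ℕ`); no constraint on `m`. [folklore] -/
def DilationMoveJac (n m : ℕ) (c : ℚ) (k : ℕ) : Prop :=
  ∀ (r r' : KZ.IntegralRep n), r.domain = {x | ∀ i, x i ∈ Ioo (0 : ℝ) 1} →
    r'.domain = {x | ∀ i, x i ∈ Ioo (0 : ℝ) 1} →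
    (∀ x ∈ r.domain, r.integrand x = r'.integrand (fun i => x i ^ m) * ((c : ℝ) * ∏ i, x i ^ k)) →
    KZ.of r - KZ.of r' ∈ KZ.changeOfVariablesRel

/-- ANCHOR 1: the crux is the member `(0,1), (0,1)` of family 1, for all `n` and `m ≥ 1`.
[folklore] -/
theorem dilationMove_iff_boxes :
    DilationMove ↔ ∀ n m : ℕ, 1 ≤ m → DilationMoveBoxes n m 0 1 0 1 := by
  simp only [DilationMove, DilationMoveBoxes, ibox_zero_one]

/-- ANCHOR 2: the crux is the member `(c, k) = (mⁿ, m − 1)` of family 2, for all `n` and `m ≥ 1`.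
[folklore] -/
theorem dilationMove_iff_jac :
    DilationMove ↔ ∀ n m : ℕ, 1 ≤ m → DilationMoveJac n m ((m : ℚ) ^ n) (m - 1) := by
  simp only [DilationMove, DilationMoveJac, Rat.cast_pow, Rat.cast_natCast]

/-! ## §A Load-bearing hypotheses -/

/-- Master lemma for family 1 in dimension 1: a pair of monomial witnesses with different values
kills `DilationMoveBoxes 1 m a b a' b'`. [folklore] -/
theorem not_boxes_of_witness {m : ℕ} {a b a' b' : ℚ} (c : ℚ) (k : ℕ) (c' : ℚ) (k' : ℕ)
    (hrel : ∀ x : Fin 1 → ℝ, (∀ i, x i ∈ Ioo (a : ℝ) b) →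
      (c : ℝ) * x 0 ^ k = (c' : ℝ) * (x 0 ^ m) ^ k' * ((m : ℝ) ^ 1 * ∏ i, x i ^ (m - 1)))
    (hne : (monoRep a b c k).value ≠ (monoRep a' b' c' k').value) :
    ¬ DilationMoveBoxes 1 m a b a' b' := by
  intro h
  refine hne (value_eq_of_mem (h (monoRep a b c k) (monoRep a' b' c' k') rfl rfl ?_))
  intro x hx
  simpa using hrel x hx

/-- **Source domain is load-bearing.** With the source box `(0,2)` (target `(0,1)`, `m = 1`,
identity map and Jacobian `1`) the statement is false: `r = [ (0,2), 1 ]`, `r' = [ (0,1), 1 ]` satisfy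
the integrand relation but have values `2 ≠ 1`. [folklore] -/
theorem not_dilationMoveBoxes_source : ¬ DilationMoveBoxes 1 1 0 2 0 1 := by
  refine not_boxes_of_witness 1 0 1 0 (fun x _ => by simp) ?_
  rw [value_monoRep 0 2 1 0 (by norm_num), value_monoRep 0 1 1 0 (by norm_num)]
  norm_num

/-- **Target domain is load-bearing.** With the target box `(0,2)` (source `(0,1)`, `m = 1`) the
statement is false: values `1 ≠ 2`. [folklore] -/
theorem not_dilationMoveBoxes_target : ¬ DilationMoveBoxes 1 1 0 1 0 2 := by
  refine not_boxes_of_witness 1 0 1 0 (fun x _ => by simp) ?_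
  rw [value_monoRep 0 1 1 0 (by norm_num), value_monoRep 0 2 1 0 (by norm_num)]
  norm_num

/-- **`Φ '' (0,1)ⁿ = (0,1)ⁿ` is load-bearing** (the unit box is special: `0, 1` are the fixed points
of `t ↦ t^m`). On the box `(1,2)` with `m = 2`: `r = [ (1,2), 2t ]`, `r' = [ (1,2), 1 ]` satisfy the
relation, values `3 ≠ 1`. [folklore] -/
theorem not_dilationMoveBoxes_shifted : ¬ DilationMoveBoxes 1 2 1 2 1 2 := by
  refine not_boxes_of_witness 2 1 1 0 (fun x _ => by simp) ?_
  rw [value_monoRep 1 2 2 1 (by norm_num), value_monoRep 1 2 1 0 (by norm_num)]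
  norm_num [integral_pow]

/-- **Positivity of the box is load-bearing** (`t ↦ t²` is not injective on `(-1,1)` and the signed
Jacobian `2t` is not `|2t|`): `r = [ (-1,1), 2t ]`, `r' = [ (-1,1), 1 ]`, values `0 ≠ 2`. [folklore] -/
theorem not_dilationMoveBoxes_symm : ¬ DilationMoveBoxes 1 2 (-1) 1 (-1) 1 := by
  refine not_boxes_of_witness 2 1 1 0 (fun x _ => by simp) ?_
  rw [value_monoRep (-1) 1 2 1 (by norm_num), value_monoRep (-1) 1 1 0 (by norm_num)]
  norm_num [integral_pow]

/-- Master lemma for family 2 in dimension 1. [folklore] -/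
theorem not_jac_of_witness {m : ℕ} {c₀ : ℚ} {k₀ : ℕ} (c : ℚ) (k : ℕ) (c' : ℚ) (k' : ℕ)
    (hrel : ∀ x : Fin 1 → ℝ, (∀ i, x i ∈ Ioo (0 : ℝ) 1) →
      (c : ℝ) * x 0 ^ k = (c' : ℝ) * (x 0 ^ m) ^ k' * ((c₀ : ℝ) * ∏ i, x i ^ k₀))
    (hne : (monoRep 0 1 c k).value ≠ (monoRep 0 1 c' k').value) :
    ¬ DilationMoveJac 1 m c₀ k₀ := by
  intro h
  refine hne (value_eq_of_mem (h (monoRep 0 1 c k) (monoRep 0 1 c' k')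
    (by simp [ibox]) (by simp [ibox]) ?_))
  intro x hx
  have hx' : ∀ i, x i ∈ Ioo (0 : ℝ) 1 := by simpa [ibox] using hx
  simpa using hrel x hx'

/-- Value of the unit-interval monomial rep: `c / (k + 1)`. [folklore] -/
theorem value_monoRep_unit (c : ℚ) (k : ℕ) : (monoRep 0 1 c k).value = c / (k + 1) := by
  rw [value_monoRep 0 1 c k (by norm_num)]
  push_cast
  rw [integral_pow]
  simp [div_eq_mul_inv]

/-- **`1 ≤ m` is load-bearing.** At `m = 0` (n = 1) the typed Jacobian factor is
`0¹ · x^(0-1) = 0`, so the relation reads `r.integrand = 0` with `r'` arbitrary on the box: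
`r = [ (0,1), 0 ]`, `r' = [ (0,1), 1 ]`, values `0 ≠ 1`. Hence the crux without `1 ≤ m` is false.
[folklore] -/
theorem not_dilationMoveJac_zero : ¬ DilationMoveJac 1 0 ((0 : ℚ) ^ 1) (0 - 1) := by
  refine not_jac_of_witness 0 0 1 0 (fun x _ => by simp) ?_
  rw [value_monoRep_unit, value_monoRep_unit]
  norm_num

/-- The crux with the hypothesis `1 ≤ m` DELETED (everything else verbatim). -/
def DilationMoveWithoutOneLe : Prop :=
  ∀ (n m : ℕ) (r r' : KZ.IntegralRep n), r.domain = {x | ∀ i, x i ∈ Ioo (0 : ℝ) 1} →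
    r'.domain = {x | ∀ i, x i ∈ Ioo (0 : ℝ) 1} →
    (∀ x ∈ r.domain, r.integrand x =
      r'.integrand (fun i => x i ^ m) * ((m : ℝ) ^ n * ∏ i, x i ^ (m - 1))) →
    KZ.of r - KZ.of r' ∈ KZ.changeOfVariablesRel

/-- Any proof of the crux must use `1 ≤ m`. [folklore] -/
theorem dilationMove_false_without_oneLe : ¬ DilationMoveWithoutOneLe := by
  intro h
  refine not_dilationMoveJac_zero fun r r' hr hr' hrel => h 1 0 r r' hr hr' ?_
  intro x hx
  simpa using hrel x hx

/-- The crux with the source-domain hypothesis `r.domain = (0,1)ⁿ` DELETED (everything else verbatim). -/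
def DilationMoveWithoutSource : Prop :=
  ∀ (n m : ℕ), 1 ≤ m → ∀ (r r' : KZ.IntegralRep n),
    r'.domain = {x | ∀ i, x i ∈ Ioo (0 : ℝ) 1} →
    (∀ x ∈ r.domain, r.integrand x =
      r'.integrand (fun i => x i ^ m) * ((m : ℝ) ^ n * ∏ i, x i ^ (m - 1))) →
    KZ.of r - KZ.of r' ∈ KZ.changeOfVariablesRel

/-- Any proof of the crux must use `r.domain = (0,1)ⁿ`. [folklore] -/
theorem dilationMove_false_without_source : ¬ DilationMoveWithoutSource := by
  intro h
  refine not_dilationMoveBoxes_source fun r r' _ hr' hrel => h 1 1 le_rfl r r' ?_ hrel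
  rw [hr', ibox_zero_one]

/-- The crux with the target-domain hypothesis `r'.domain = (0,1)ⁿ` DELETED (everything else verbatim). -/
def DilationMoveWithoutTarget : Prop :=
  ∀ (n m : ℕ), 1 ≤ m → ∀ (r r' : KZ.IntegralRep n),
    r.domain = {x | ∀ i, x i ∈ Ioo (0 : ℝ) 1} →
    (∀ x ∈ r.domain, r.integrand x =
      r'.integrand (fun i => x i ^ m) * ((m : ℝ) ^ n * ∏ i, x i ^ (m - 1))) →
    KZ.of r - KZ.of r' ∈ KZ.changeOfVariablesRel

/-- Any proof of the crux must use `r'.domain = (0,1)ⁿ`. [folklore] -/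
theorem dilationMove_false_without_target : ¬ DilationMoveWithoutTarget := by
  intro h
  refine not_dilationMoveBoxes_target fun r r' hr _ hrel => h 1 1 le_rfl r r' ?_ hrel
  rw [hr, ibox_zero_one]

/-- The crux with the Jacobian factor DELETED from the integrand relation
(`r.integrand x = r'.integrand (xᵢ^m)ᵢ`; everything else verbatim). -/
def DilationMoveWithoutJacobian : Prop :=
  ∀ (n m : ℕ), 1 ≤ m → ∀ (r r' : KZ.IntegralRep n),
    r.domain = {x | ∀ i, x i ∈ Ioo (0 : ℝ) 1} → r'.domain = {x | ∀ i, x i ∈ Ioo (0 : ℝ) 1} →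
    (∀ x ∈ r.domain, r.integrand x = r'.integrand (fun i => x i ^ m)) →
    KZ.of r - KZ.of r' ∈ KZ.changeOfVariablesRel

/-- **The Jacobian factor is load-bearing**: factor `1 = 1·x⁰` at `m = 2`, `n = 1` is false
(`r' = [ (0,1), t ]`, `r = [ (0,1), t² ]`, values `1/3 ≠ 1/2`). [folklore] -/
theorem not_dilationMoveJac_noJacobian : ¬ DilationMoveJac 1 2 1 0 := by
  refine not_jac_of_witness 1 2 1 1 (fun x _ => by simp) ?_
  rw [value_monoRep_unit, value_monoRep_unit]
  norm_num

/-- Any proof of the crux must use the Jacobian factor. [folklore] -/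
theorem dilationMove_false_without_jacobian : ¬ DilationMoveWithoutJacobian := by
  intro h
  refine not_dilationMoveJac_noJacobian fun r r' hr hr' hrel => h 1 2 (by norm_num) r r' hr hr' ?_
  intro x hx
  simpa using hrel x hx

/-! ## §B Tightness: the Jacobian monomial is unique (dimension 1) -/

/-- **Necessity of `(c, k) = (m, m − 1)`.** If the dimension-1 move with factor `c·t^k` is valid
then `c = k + 1` (test integrand `r' = 1`: values `c/(k+1)` vs `1`) and then `k = m − 1`
(test integrand `r' = t`: values `c/(m+k+1)` vs `1/2`). [folklore] -/
theorem dilationMoveJac_one_necessary {m : ℕ} (hm : 1 ≤ m) {c : ℚ} {k : ℕ}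
    (h : DilationMoveJac 1 m c k) : c = m ∧ k = m - 1 := by
  -- test 1: r' = 1, r = c t^k
  have h1 : (monoRep 0 1 c k).value = (monoRep 0 1 1 0).value := by
    by_contra hne
    exact not_jac_of_witness c k 1 0 (fun x _ => by simp) hne h
  rw [value_monoRep_unit, value_monoRep_unit] at h1
  have hc : (c : ℝ) = k + 1 := by
    have hk : (k : ℝ) + 1 ≠ 0 := by positivity
    field_simp at h1
    push_cast at h1 ⊢
    linarith
  -- test 2: r' = t, r = c t^(m+k)
  have h2 : (monoRep 0 1 c (m + k)).value = (monoRep 0 1 1 1).value := by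
    by_contra hne
    exact not_jac_of_witness c (m + k) 1 1
      (fun x _ => by simp only [Fin.prod_univ_one, Rat.cast_one, one_mul, pow_one]; ring) hne h
  rw [value_monoRep_unit, value_monoRep_unit] at h2
  push_cast at h2
  rw [hc] at h2
  have hmk : (m : ℝ) + k + 1 ≠ 0 := by positivity
  have hkm : (k : ℝ) = m - 1 := by
    field_simp at h2
    linarith
  have hk' : k = m - 1 := by
    have : (k : ℝ) = ((m - 1 : ℕ) : ℝ) := by rw [hkm, Nat.cast_sub hm, Nat.cast_one]
    exact_mod_cast this
  refine ⟨?_, hk'⟩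
  have : (c : ℝ) = (m : ℝ) := by
    rw [hc, hk', Nat.cast_sub hm, Nat.cast_one]; ring
  exact_mod_cast this


/-- **TIGHTNESS (dimension 1), relative to the crux.** Given the crux, the move with Jacobian
factor `c·t^k` is valid iff `(c, k) = (m, m − 1)`: the crux's Jacobian is the unique monomial that
works. [folklore] -/
theorem dilationMoveJac_one_iff_of (hD : DilationMove) {m : ℕ} (hm : 1 ≤ m) (c : ℚ) (k : ℕ) :
    DilationMoveJac 1 m c k ↔ c = m ∧ k = m - 1 := by
  refine ⟨dilationMoveJac_one_necessary hm, ?_⟩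
  rintro ⟨rfl, rfl⟩
  have h := dilationMove_iff_jac.1 hD 1 m hm
  rwa [pow_one] at h

end Summit.KontsevichZagierPeriods.HurwitzMicroSectors.DilationMoveNegative

end
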